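import Literature.AnabelianGeometry.EtaleTheta.Discharge.Sec2Cor218iThetaSubquotients
import Literature.AnabelianGeometry.EtaleTheta.Discharge.Sec1Thm16GKN
import Literature.AnabelianGeometry.EtaleTheta.Discharge.Sec2Prop24ModelCharacteristic
import HarnessLib

/-!
# [EtTh] Cor. 2.18 (i) AT THE §1 MODEL, from the Thm. 1.6 (i) sub-DAG inputs (proof-only)

S. Mochizuki, *The étale theta function and its Frobenioid-theoretic manifestations* [EtTh], Publ. RIMS **45**
(2009), §2, Cor. 2.18 (i), PRIMS PDF p. 60 (printed 286), proof p. 62: "An algorithm for constructing the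
subquotients `Π•_Y; Π•_Ÿ; (l·Δ•_Θ); (Δ•_X)^Θ; (Π•_X)^Θ; …` (respectively, `(Π•_X ↠) G•_K`) is described in
the proofs of Propositions 1.8, 2.4 [cf. also the definitions of the various coverings involved!]
(respectively, in the proof of [Mzk2], Lemma 1.3.8). An algorithm for constructing the labels of cuspidal
decomposition groups is described in the proof of Corollary 2.9" [cite: MochizukiEtTh2009, Cor 2.18(i) p.60].

Cell abc-iut, layer L2, seat abc-iut-L6-d6 (gen 3); row #2 of abc-iut-L2-lead (03:27:01Z, "EtTh:Cor2.18(i) AT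
THE MODEL"). The named FACT `RigidData.Cor218_i` (abc-iut-L2-t2, F-0620) is consumed BY NAME all over the
[IUTchII] §1 cone; at abc-iut-L2-t8's §1 model `C.rigidData μ hC hS h15 L` (`PiX = Π^tp_{X̲̲} = C.Huu`)
abc-iut-L2-d1's `rigidData_cor218_i_of_extends` (`Sec2Cor218iThetaSubquotients`, the BACKBONE used here)
reduces it to (a) "every `γ ∈ Aut(Π^tp_{X̲̲})` extends to `Γ ∈ Aut(Π^tp_X)` stabilising `Δ^tp_X` AND `Π^tp_Ÿ`" +
(b) the cusp-label clause. THIS FILE removes the `Π^tp_Ÿ`-stabilisation from (a): it is DERIVED from the inputs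
of the [EtTh] Thm. 1.6 (i) sub-DAG (`plan/L2/SUBDAG-EtTh-Thm16.md`, abc-iut-L6-d5 / abc-iut-w5-d051:
`Thm16Sub.thm16i_of_isKernelOfAction`), so that EVERY residual binder of Cor. 2.18 (i) at the model is one
ALREADY NAMED there (no new gap class):

* `hext₀` — K-core EXTENSION ONLY: every topological automorphism of `Π^tp_{X̲̲}` extends to one of `Π^tp_X`
  (print: "Proposition 2.4", `X̲̲` admits the `K`-core `C`, [Mzk3] Thm. 2.4; GAP-LEDGER G-L6d6-2 family, in
  its weakest form — no stabilisation clause);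
* `hΔ` — [AbsAnab] Lem. 1.3.8 ("[Mzk2], Lemma 1.3.8"): every topological automorphism of `Π^tp_X` stabilises
  `Δ^tp_X` (SUBDAG-EtTh-Thm16 L01, the tree's standard `hΔ` shape; F-0007 family);
* `hZ : Thm16Sub.KerToZIsCompactlyGenerated D` (L02; G-L6d6-1), `hK : Thm16Sub.GKNIsKernelOfAction D 2` (L04;
  G-w5d051-1), `hYN : Thm16Sub.GtpYNFromCusp D 2` (L05; debt R2), `h65 : D.IsoPreservesCuspidalDecomp D` (L03;
  [SemiAnbd] Thm. 6.5 (iii), F-1704 family), `hex` (a cusp of `Y^log` lying in `Π^tp_Y`, the datum L05 starts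
  from) — "the definitions of the various coverings involved" + "Proposition 1.8";
* `hcusp` — the cusp-LABEL clause ("the proof of Corollary 2.9"; abc-iut-L2-d3's P-C6 class), unchanged.

Also recorded: the `Π•_Y`-clause ALONE needs only the `X̲̲`-reading of L02 (`rigidData_map_PiY_eq_of_compactlyGenerated`,
from `Sec2Prop24ModelCharacteristic`), with no extension at all. HONEST FRAMING: [EtTh] is refereed; F-0620 stays
a named FACT of the cell — this is a CONDITIONAL reduction at the model; nothing here asserts the binders; no side
is taken on [IUTchIII] Cor. 3.12; typed ≠ proved.
-/

noncomputable section

namespace Literature.AnabelianGeometry.EtaleTheta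

namespace ThetaSetting.EtaleThetaData.DoubleUnderline

variable {p : ℕ} [Fact p.Prime] {D : ThetaSetting p} {E : D.EtaleThetaData} {l : ℕ}
  (C : E.DoubleUnderline l) {N : ℕ+} (μ : D.CyclotomeMod l N) (hC : D.Compat) (hS : D.Sec2Hyps)
  (h15 : Prop15iii E hC) (L : C.CuspLabels)

/-- **The `Π^tp_Ÿ`-stabilisation of an extension is a THEOREM of the Thm. 1.6 (i) sub-DAG**: every topological
automorphism `Γ` of `Π^tp_X` stabilising `Δ^tp_X` satisfies `Γ(Π^tp_Ÿ) = Π^tp_Ÿ`, granted L02/L03/L04/L05 and a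
cusp of `Y^log` (abc-iut-w5-d051's `Thm16Sub.thm16i_of_isKernelOfAction` at `α = β`).
[cite: MochizukiEtTh2009, Thm 1.6 (i) p.24] -/
theorem map_GtpYdd_eq_of_thm16Inputs (Γ : D.PiTemp ≃ₜ* D.PiTemp)
    (hΔ : D.DeltaTemp.map Γ.toMulEquiv.toMonoidHom = D.DeltaTemp)
    (hZ : Thm16Sub.KerToZIsCompactlyGenerated D) (hK : Thm16Sub.GKNIsKernelOfAction D 2)
    (hYN : Thm16Sub.GtpYNFromCusp D 2) (h65 : D.IsoPreservesCuspidalDecomp D.toTemperedCurve)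
    (hex : ∃ Dc : Subgroup D.PiTemp, D.IsCuspidalDecompositionGroup Dc ∧ Dc ≤ D.GtpY) :
    D.GtpYdd.map Γ.toMulEquiv.toMonoidHom = D.GtpYdd :=
  Thm16Sub.thm16i_of_isKernelOfAction (γ := Γ) (hΔ := hΔ) hZ hZ hK hK hYN hYN h65 hex

/-- **[EtTh] Cor. 2.18 (i) AT THE §1 MODEL from the Thm. 1.6 (i) sub-DAG inputs**: the named fact
`RigidData.Cor218_i` for abc-iut-L2-t8's `C.rigidData μ hC hS h15 L` (six invariance clauses under every
topological automorphism of `Π^tp_{X̲̲}`: `Π^tp_{Y̲̲}`, `Π^tp_{Ÿ̲̲}`, `Δ`, `Ker(→ (Π^tp_X)^Θ)`, the inverse image of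
`l·Δ_Θ`, the cusp labels), GIVEN: a K-core extension of each `γ` to `Π^tp_X` (`hext₀`, no stabilisation clause),
[AbsAnab] Lem. 1.3.8 (`hΔ`), the Thm. 1.6 (i) sub-DAG binders L02/L04/L05/L03 + a cusp of `Y^log`, and the
cusp-label clause — abc-iut-L2-d1's backbone `rigidData_cor218_i_of_extends` with its `Π^tp_Ÿ`-hypothesis
DISCHARGED by `map_GtpYdd_eq_of_thm16Inputs`. [cite: MochizukiEtTh2009, Cor 2.18(i) p.60] -/
theorem rigidData_cor218_i_of_thm16Inputs
    (hext₀ : ∀ γ : ↥C.Huu ≃ₜ* ↥C.Huu, ∃ Γ : D.PiTemp ≃ₜ* D.PiTemp,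
      ∀ h : C.Huu, Γ (h : D.PiTemp) = ((γ h : C.Huu) : D.PiTemp))
    (hΔ : ∀ Γ : D.PiTemp ≃ₜ* D.PiTemp, D.DeltaTemp.map Γ.toMulEquiv.toMonoidHom = D.DeltaTemp)
    (hZ : Thm16Sub.KerToZIsCompactlyGenerated D) (hK : Thm16Sub.GKNIsKernelOfAction D 2)
    (hYN : Thm16Sub.GtpYNFromCusp D 2) (h65 : D.IsoPreservesCuspidalDecomp D.toTemperedCurve)
    (hex : ∃ Dc : Subgroup D.PiTemp, D.IsCuspidalDecompositionGroup Dc ∧ Dc ≤ D.GtpY)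
    (hcusp : ∀ (γ : ↥C.Huu ≃ₜ* ↥C.Huu) (a : ZMod l),
      (fun H : Subgroup C.Huu => H.map γ.toMulEquiv.toMonoidHom) '' L.cuspX a = L.cuspX a) :
    (C.rigidData μ hC hS h15 L).Cor218_i := by
  refine C.rigidData_cor218_i_of_extends μ hC hS h15 L (fun γ => ?_) hcusp
  obtain ⟨Γ, hΓ⟩ := hext₀ γ
  exact ⟨Γ, hΓ, hΔ Γ, map_GtpYdd_eq_of_thm16Inputs Γ (hΔ Γ) hZ hK hYN h65 hex⟩

/-- The same with [AbsAnab] Lem. 1.3.8 asked only of the extensions produced by `hext₀` (the two anabelian inputs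
bundled as in print: "Propositions 1.8, 2.4 … [Mzk2], Lemma 1.3.8"). [cite: MochizukiEtTh2009, Cor 2.18(i) p.60] -/
theorem rigidData_cor218_i_of_thm16Inputs'
    (hext : ∀ γ : ↥C.Huu ≃ₜ* ↥C.Huu, ∃ Γ : D.PiTemp ≃ₜ* D.PiTemp,
      (∀ h : C.Huu, Γ (h : D.PiTemp) = ((γ h : C.Huu) : D.PiTemp)) ∧
      D.DeltaTemp.map Γ.toMulEquiv.toMonoidHom = D.DeltaTemp)
    (hZ : Thm16Sub.KerToZIsCompactlyGenerated D) (hK : Thm16Sub.GKNIsKernelOfAction D 2)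
    (hYN : Thm16Sub.GtpYNFromCusp D 2) (h65 : D.IsoPreservesCuspidalDecomp D.toTemperedCurve)
    (hex : ∃ Dc : Subgroup D.PiTemp, D.IsCuspidalDecompositionGroup Dc ∧ Dc ≤ D.GtpY)
    (hcusp : ∀ (γ : ↥C.Huu ≃ₜ* ↥C.Huu) (a : ZMod l),
      (fun H : Subgroup C.Huu => H.map γ.toMulEquiv.toMonoidHom) '' L.cuspX a = L.cuspX a) :
    (C.rigidData μ hC hS h15 L).Cor218_i := by
  refine C.rigidData_cor218_i_of_extends μ hC hS h15 L (fun γ => ?_) hcusp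
  obtain ⟨Γ, hΓ, hΔ⟩ := hext γ
  exact ⟨Γ, hΓ, hΔ, map_GtpYdd_eq_of_thm16Inputs Γ hΔ hZ hK hYN h65 hex⟩

/-- **The `Π•_Y`-clause alone needs NO extension**: for the model rigid data, `γ(Π^tp_{Y̲̲}) = Π^tp_{Y̲̲}` for every
topological automorphism `γ` of `Π^tp_{X̲̲}`, granted only that `Π^tp_{Y̲̲}` is topologically generated by the compact
subgroups of `Π^tp_{X̲̲}` (the `X̲̲`-reading of L02, G-L6d6-1; `Sec2Prop24ModelCharacteristic`).
[cite: MochizukiEtTh2009, Cor 2.18(i) p.60] -/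
theorem rigidData_map_PiY_eq_of_compactlyGenerated
    (hYuu : D.GtpY.subgroupOf C.Huu ≤
      (Subgroup.closure {h : C.Huu | ∃ K : Subgroup C.Huu, IsCompact (K : Set C.Huu) ∧ h ∈ K}).topologicalClosure)
    (γ : ↥C.Huu ≃ₜ* ↥C.Huu) :
    (C.rigidData μ hC hS h15 L).PiY.map γ.toMulEquiv.toMonoidHom = (C.rigidData μ hC hS h15 L).PiY :=
  C.map_GtpY_subgroupOf_Huu_eq_of_compactlyGenerated hYuu γ

/-- **The `Π•_Ÿ`-clause for the model rigid data from the Thm. 1.6 (i) inputs** (extension + L01–L05), as a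
stand-alone statement. [cite: MochizukiEtTh2009, Cor 2.18(i) p.60] -/
theorem rigidData_map_PiYdd_eq_of_thm16Inputs
    (hext₀ : ∀ γ : ↥C.Huu ≃ₜ* ↥C.Huu, ∃ Γ : D.PiTemp ≃ₜ* D.PiTemp,
      ∀ h : C.Huu, Γ (h : D.PiTemp) = ((γ h : C.Huu) : D.PiTemp))
    (hΔ : ∀ Γ : D.PiTemp ≃ₜ* D.PiTemp, D.DeltaTemp.map Γ.toMulEquiv.toMonoidHom = D.DeltaTemp)
    (hZ : Thm16Sub.KerToZIsCompactlyGenerated D) (hK : Thm16Sub.GKNIsKernelOfAction D 2)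
    (hYN : Thm16Sub.GtpYNFromCusp D 2) (h65 : D.IsoPreservesCuspidalDecomp D.toTemperedCurve)
    (hex : ∃ Dc : Subgroup D.PiTemp, D.IsCuspidalDecompositionGroup Dc ∧ Dc ≤ D.GtpY)
    (γ : ↥C.Huu ≃ₜ* ↥C.Huu) :
    (C.rigidData μ hC hS h15 L).PiYdd.map γ.toMulEquiv.toMonoidHom = (C.rigidData μ hC hS h15 L).PiYdd := by
  obtain ⟨Γ, hΓ⟩ := hext₀ γ
  exact C.map_subgroupOf_Huu_eq_of_extends γ Γ hΓ _
    (map_GtpYdd_eq_of_thm16Inputs Γ (hΔ Γ) hZ hK hYN h65 hex)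

end ThetaSetting.EtaleThetaData.DoubleUnderline

end Literature.AnabelianGeometry.EtaleTheta

end
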